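import Literature.AnabelianGeometry.EtaleTheta.Discharge.Sec3Cor38iiWeakOfRatSupport
import HarnessLib

/-!
# [EtTh] Corollary 3.8 (ii) for SELF-equivalences over the WEAK vocabulary — the shape [IUTchI] Example 3.2 (iii)
# quotes: "the base-field-theoretic hull … may be reconstructed category-theoretically from `F̲_v`"

S. Mochizuki, *The étale theta function and its Frobenioid-theoretic manifestations*, Publ. RIMS **45** (2009),
Cor. 3.8 (ii), PDF pp. 80–81 [cite: MochizukiEtTh2009, Cor 3.8 p.81]; S. Mochizuki, *Inter-universal Teichmüller
theory I*, Publ. RIMS **57** (2021), Example 3.2 (iii), kurims p. 70: "the `p_v`-adic Frobenioid … `C_v ⊆ F̲_v` … may be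
reconstructed category-theoretically from `F̲_v` [cf. [EtTh], Corollary 3.8, (ii) …]" [claim: Mochizuki2012, status:
disputed] — here ONLY the [EtTh]-level statement is proved; the [IUTchI] node (`BadLocalFrobenioid.CFromF` =
`ReconstructibleAlong B.hull`, abc-iut-L5, a schema over an interface) is NOT touched.

abc-iut cell; PROOF-ONLY corollary file (0 definitions) written by abc-iut-L1-t12 (gen 6) over this seat's
`Sec3Cor38iiWeak.lean` (p441772) / `Sec3Cor38iiWeakOfRatSupport.lean` (p442038).  For a SINGLE tempered Frobenioid
`C` over the weak monoid vocabulary (the `Ÿ` / `Z_∞`-type data of cell finding F-L2d2-1, where [IUTchI] Ex. 3.2 works)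
and ANY self-equivalence `e : C ⥲ C`, the Cor. 3.8 data `Cor38Hyp C C` is `⟨e, (hD, hD), (hnd, hnd)⟩`, so Cor. 3.8
(ii) yields: `e` preserves the base-field-theoretic morphisms AND there is a self-equivalence `e'` of the REAL hull
category `C^{bs-fld}` with `hull ⋙ e ≅ e' ⋙ hull` — literally the clause
`∀ e, ∃ e', Nonempty (hull ⋙ e.functor ≅ e'.functor ⋙ hull)` of abc-iut-L5's `ReconstructibleAlong C.hull`
(up to that definition's single-universe packaging, which the L5 bridge supplies):
* `TemperedFrobenioid.hull_selfEquivalence_weak_of_criteria` — modulo `hF` ([FrdI] Thm. 5.2 (ii)), `D` of FSMFF-type,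
  `Φ` non-dilating, `D` Div-slim relative to `Φ` (Cor. 3.8 (ii)'s hypotheses), the criterion C38-L05 at THE perfection
  and [EtTh] Rmk. 3.6.3;
* `TemperedFrobenioid.hull_selfEquivalence_weak_of_coord` — the last two ⟸ the print-level clauses `hP34Λ`, `hNZ`,
  `hQ`, `hFinv`;
* `TemperedFrobenioid.hull_selfEquivalence_ofRlfZWeak` / `…_ofRlfQWeak` — at the CONSTRUCTED data of monoid type
  `ℤ` / `ℚ` (`RealifiedDivisorMonoids.ofRlfZWeak` / `ofRlfQWeak`): inputs `hF`, `dm.Prop34`, `hF₀inv`, `hcyc`, `hZQ`,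
  `hsat` (`B₀`/`Φ₀`-level print statements only).
HONEST FRAMING: refereed pre-IUT material ([EtTh] §3); composition only; nothing here bears on [IUTchIII] Cor. 3.12 or
asserts anything about the [IUTchI] schema beyond supplying the [EtTh] statement it quotes; no side taken; typed ≠ proved.
-/

noncomputable section

namespace Literature.AnabelianGeometry.EtaleTheta

open CategoryTheory Opposite Function Literature.AlgebraicGeometry.Frobenioids

universe u₀ v₀ u v w

namespace TemperedFrobenioid

section Weak

variable {D₀ : Type u₀} [Category.{v₀} D₀] {T : RealifiedDivisorMonoids (D₀ := D₀) treeMonoidVocabWeak.{w}}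
  {D : Type u} [Category.{v} D] {VD : FrdICatStub.{u, v, w} D}

/-- **[EtTh] Cor. 3.8 (ii) for a SELF-equivalence `e : C ⥲ C` over the weak monoid vocabulary** ("`Ψ` preserves the
base-field-theoretic morphisms and induces a compatible equivalence `C₁^{bs-fld} ⥲ C₂^{bs-fld}`", with `C₁ = C₂ = C`,
`Ψ = e`) — modulo `hF`, the criterion C38-L05 at THE perfection and Rmk. 3.6.3: the Cor. 3.8 data are
`⟨e, (hD, hD), (hnd, hnd)⟩`, the knit is `Cor38Hyp.cor38_ii_weak_of_criteria`.  The second conjunct is the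
`ReconstructibleAlong C.hull`-clause [IUTchI] Ex. 3.2 (iii) quotes. [cite: MochizukiEtTh2009, Cor 3.8 p.81] -/
theorem hull_selfEquivalence_weak_of_criteria (C : TemperedFrobenioid T D VD) (hD : IsOfFSMFFType D)
    (hnd : ∀ (A : Dᵒᵖ) (f : A ⟶ A), treeMonoidVocabWeak.{w}.IsNonDilating (C.Φ.carrier A) (C.Φ.pull f))
    (hds : ∀ (A : D) (α : Aut (Over.forget A)),
      (∀ (B : Over A) (x : C.divisorMonoid.obj (op B.left)),
        Literature.AlgebraicGeometry.Frobenioids.pull C.divisorMonoid (α.hom.app B) x = x) → α = 1)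
    (hF : PreFrobenioid.IsFrobenioid C.toElem)
    (h5 : C.BsFldPreStepLimitCriterion (PreFrobenioidData.perfection hF)) (hR : C.Remark363)
    (e : C.category ≌ C.category) :
    (∀ {A B : C.category} (f : A ⟶ B), C.IsBaseFieldTheoretic f ↔ C.IsBaseFieldTheoretic (e.functor.map f)) ∧
      ∃ e' : C.hullCategory ≌ C.hullCategory, Nonempty (C.hull ⋙ e.functor ≅ e'.functor ⋙ C.hull) :=
  (Cor38Hyp.mk (C₁ := C) (C₂ := C) e ⟨hD, hD⟩ ⟨hnd, hnd⟩).cor38_ii_weak_of_criteria hF hF h5 h5 hR hR hds hds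

/-- **The same with C38-L05 and Rmk. 3.6.3 consumed from the print-level clauses** `hP34Λ` (Prop. 3.4 (ii) at monoid
type `Λ`), `hNZ` (Def. 3.6 (ii)(b)), `hQ` (Rmk. 3.3.1 / GAP G-w4d084-3), `hFinv` (Def. 3.6 (ii)(b)/(iii)).
[cite: MochizukiEtTh2009, Cor 3.8 p.81] -/
theorem hull_selfEquivalence_weak_of_coord (C : TemperedFrobenioid T D VD) (hD : IsOfFSMFFType D)
    (hnd : ∀ (A : Dᵒᵖ) (f : A ⟶ A), treeMonoidVocabWeak.{w}.IsNonDilating (C.Φ.carrier A) (C.Φ.pull f))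
    (hds : ∀ (A : D) (α : Aut (Over.forget A)),
      (∀ (B : Over A) (x : C.divisorMonoid.obj (op B.left)),
        Literature.AlgebraicGeometry.Frobenioids.pull C.divisorMonoid (α.hom.app B) x = x) → α = 1)
    (hF : PreFrobenioid.IsFrobenioid C.toElem)
    (hP34Λ : ∀ (Y : D₀ᵒᵖ) (b : T.BΛ.obj Y) (r : T.ΦR.obj Y),
      T.divΛ Y b = Algebra.GrothendieckGroup.of r → b ∈ T.FΛ Y)
    (hNZ : ∀ A : Dᵒᵖ, ∃ u : (T.BΛ.obj (C.baseOp A) : Type w) × Algebra.GrothendieckGroup (C.Φ.carrier A),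
      u ∈ C.cnstFn A ∧ ∃ Z : C.Φ.carrier A, Z ≠ 1 ∧ u.2 = Algebra.GrothendieckGroup.of Z)
    (hQ : ∀ (W : D) (𝔮 : Primes (Perfection (C.divisorMonoid.obj (op W)))),
      IsQMonoprime (PfAt (C.divisorMonoid.obj (op W)) 𝔮))
    (hFinv : ∀ (Y : D₀ᵒᵖ) (b : T.BΛ.obj Y), b ∈ T.FΛ Y → ∃ b' ∈ T.FΛ Y, b' * b = 1)
    (e : C.category ≌ C.category) :
    (∀ {A B : C.category} (f : A ⟶ B), C.IsBaseFieldTheoretic f ↔ C.IsBaseFieldTheoretic (e.functor.map f)) ∧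
      ∃ e' : C.hullCategory ≌ C.hullCategory, Nonempty (C.hull ⋙ e.functor ≅ e'.functor ⋙ C.hull) :=
  (Cor38Hyp.mk (C₁ := C) (C₂ := C) e ⟨hD, hD⟩ ⟨hnd, hnd⟩).cor38_ii_weak_of_coord hF hF hP34Λ hNZ hQ hFinv
    hP34Λ hNZ hQ hFinv hds hds

end Weak

section OfRlfWeak

variable {D₀ : Type u₀} [Category.{v₀} D₀] {dm : DivisorMonoids.{u₀, v₀, w} D₀}
  {hpf : ∀ Y : D₀ᵒᵖ, IsPerfFactorialCof (dm.Φ₀.obj Y)}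
  {V₁ : FrdIMonoidStub.{w}} {V₀ : FrdICatStub.{u₀, v₀, w} D₀}
  {D : Type u} [Category.{v} D] {VD : FrdICatStub.{u, v, w} D}

/-- **[EtTh] Cor. 3.8 (ii) for a SELF-equivalence at the CONSTRUCTED weak data of monoid type `ℤ`**
(`RealifiedDivisorMonoids.ofRlfZWeak dm hpf` — the `Ÿ` / `Z_∞`-type data of F-L2d2-1): every self-equivalence `e` of
`C` preserves the base-field-theoretic morphisms and lifts compatibly to a self-equivalence of the REAL hull category —
inputs `hF` and the `B₀`/`Φ₀`-level print statements `dm.Prop34`, `hF₀inv`, `hcyc`, `hZQ`, `hsat` only.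
[cite: MochizukiEtTh2009, Cor 3.8 p.81] -/
theorem hull_selfEquivalence_ofRlfZWeak (C : TemperedFrobenioid (RealifiedDivisorMonoids.ofRlfZWeak dm hpf) D VD)
    (hD : IsOfFSMFFType D)
    (hnd : ∀ (A : Dᵒᵖ) (f : A ⟶ A), treeMonoidVocabWeak.{w}.IsNonDilating (C.Φ.carrier A) (C.Φ.pull f))
    (hds : ∀ (A : D) (α : Aut (Over.forget A)),
      (∀ (B : Over A) (x : C.divisorMonoid.obj (op B.left)),
        Literature.AlgebraicGeometry.Frobenioids.pull C.divisorMonoid (α.hom.app B) x = x) → α = 1)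
    (hF : PreFrobenioid.IsFrobenioid C.toElem) (h34 : dm.Prop34 V₁ V₀)
    (hF₀inv : ∀ (Y : D₀ᵒᵖ) (b : dm.B₀.obj Y), b ∈ dm.F₀ Y → ∃ b' ∈ dm.F₀ Y, b' * b = 1)
    (hcyc : ∀ Y : D₀ᵒᵖ, ∃ d : dm.Φ₀.obj Y, ∀ b ∈ dm.F₀ Y, ∃ n : ℤ,
      dm.div₀ Y b = Algebra.GrothendieckGroup.of d ^ n)
    (hZQ : ∀ (W : D) (𝔭 : Primes (dm.Φ₀.obj (C.baseOp (op W)))),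
      IsZMonoprime ↥𝔭.submonoid ∨ IsQMonoprime ↥𝔭.submonoid)
    (hsat : ∀ (W : D), ∀ x ∈ C.Φ.carrier (op W), ∃ (N : ℕ+) (d : dm.Φ₀.obj (C.baseOp (op W))),
      x ^ (N : ℕ) = (hpf (C.baseOp (op W))).weak.toRealification (Perfection.of _ d))
    (e : C.category ≌ C.category) :
    (∀ {A B : C.category} (f : A ⟶ B), C.IsBaseFieldTheoretic f ↔ C.IsBaseFieldTheoretic (e.functor.map f)) ∧
      ∃ e' : C.hullCategory ≌ C.hullCategory, Nonempty (C.hull ⋙ e.functor ≅ e'.functor ⋙ C.hull) :=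
  (Cor38Hyp.mk (C₁ := C) (C₂ := C) e ⟨hD, hD⟩ ⟨hnd, hnd⟩).cor38_ii_ofRlfZWeak_of_ratSupport hF hF h34 hF₀inv hcyc
    hZQ hsat h34 hF₀inv hcyc hZQ hsat hds hds

/-- The same at the constructed weak data of monoid type `ℚ` (`RealifiedDivisorMonoids.ofRlfQWeak dm hpf`).
[cite: MochizukiEtTh2009, Cor 3.8 p.81] -/
theorem hull_selfEquivalence_ofRlfQWeak (C : TemperedFrobenioid (RealifiedDivisorMonoids.ofRlfQWeak dm hpf) D VD)
    (hD : IsOfFSMFFType D)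
    (hnd : ∀ (A : Dᵒᵖ) (f : A ⟶ A), treeMonoidVocabWeak.{w}.IsNonDilating (C.Φ.carrier A) (C.Φ.pull f))
    (hds : ∀ (A : D) (α : Aut (Over.forget A)),
      (∀ (B : Over A) (x : C.divisorMonoid.obj (op B.left)),
        Literature.AlgebraicGeometry.Frobenioids.pull C.divisorMonoid (α.hom.app B) x = x) → α = 1)
    (hF : PreFrobenioid.IsFrobenioid C.toElem) (h34 : dm.Prop34 V₁ V₀)
    (hF₀inv : ∀ (Y : D₀ᵒᵖ) (b : dm.B₀.obj Y), b ∈ dm.F₀ Y → ∃ b' ∈ dm.F₀ Y, b' * b = 1)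
    (hcyc : ∀ Y : D₀ᵒᵖ, ∃ d : dm.Φ₀.obj Y, ∀ b ∈ dm.F₀ Y, ∃ n : ℤ,
      dm.div₀ Y b = Algebra.GrothendieckGroup.of d ^ n)
    (hZQ : ∀ (W : D) (𝔭 : Primes (dm.Φ₀.obj (C.baseOp (op W)))),
      IsZMonoprime ↥𝔭.submonoid ∨ IsQMonoprime ↥𝔭.submonoid)
    (hsat : ∀ (W : D), ∀ x ∈ C.Φ.carrier (op W), ∃ (N : ℕ+) (d : dm.Φ₀.obj (C.baseOp (op W))),
      x ^ (N : ℕ) = (hpf (C.baseOp (op W))).weak.toRealification (Perfection.of _ d))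
    (e : C.category ≌ C.category) :
    (∀ {A B : C.category} (f : A ⟶ B), C.IsBaseFieldTheoretic f ↔ C.IsBaseFieldTheoretic (e.functor.map f)) ∧
      ∃ e' : C.hullCategory ≌ C.hullCategory, Nonempty (C.hull ⋙ e.functor ≅ e'.functor ⋙ C.hull) :=
  (Cor38Hyp.mk (C₁ := C) (C₂ := C) e ⟨hD, hD⟩ ⟨hnd, hnd⟩).cor38_ii_ofRlfQWeak_of_ratSupport hF hF h34 hF₀inv hcyc
    hZQ hsat h34 hF₀inv hcyc hZQ hsat hds hds

end OfRlfWeak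

end TemperedFrobenioid

end Literature.AnabelianGeometry.EtaleTheta

end
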